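import Literature.MathematicalPhysics.QuantumFieldTheory.Balaban1983to89.B8Lemma1NonAbelianRec

/-!
# `Balaban1983to89.B8Ineq130Rec` — [Balaban1985RegularSpaces] Sect. F (1.130) (with (1.128)∕(1.129)): the descent «Applying Lemma 1 many times,
# as in the proof of (1.65), (1.66)» through the tower of cubes `□̃^{(j)}`, RE-RUN FOR THE RECORD's symmetric block averaging (0.4) of
# [Balaban1987RG1] (`BlockAveragingZd.avgIterZ`): CENTRED blocks, cube tower `[Lⁿlo − s_n𝟙, Lⁿhi + s_n𝟙]`, Lemma 1 of `B8Lemma1NonAbelianRec`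

statement-level skeleton of published theorems with citation tags; proofs where landed; nothing here is a claim about the Yang–Mills mass gap

CITATION HEADER.  [6] = T. Bałaban, *Spaces of regular gauge field configurations on a lattice and gauge fixing conditions*, Commun. Math. Phys. **99**
(1985) 75–102 [Balaban1985RegularSpaces], Sect. F pp. 98–99, verbatim p. 98: *«Let us take a sequence of cubes □₀, □₁, …, □_{k−1}, □_k, □ … for
every j the cube □_j is a sum of the big blocks of the lattice T_{L^{−j}} … By the assumptions (1.7)–(1.9) and Proposition 2 from [3] we have
|Ū₀ʲ(∂p) − 1| < 2α₀L²(Lʲη)², p ⊂ □̃^{(j)}, j = 0, 1, …, k. (1.128) … Ū₀′ᵏ(Γ_{y,x}) = 1 for x ∈ □̃^{(k)}, where y is a center of □̃^{(k)}. These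
last conditions imply |Ū₀′ᵏ(x,x′) − 1| < |x − y|2L²α₀ ≤ (M + 4R₁M₁)dL²α₀ (1.129) … Applying Lemma 1 many times, as in the proof of (1.65),
(1.66),»* p. 99: *«we get |Ū₀′ʲ(x,x′) − 1| < 8d²L²(L^{−2(k−j−1)} + … + L^{−2} + 1)α₀ + (M + 4R₁M₁)dL²α₀ < 11d²L²α₀ + 5dL²Mα₀ < 6dL²Mα₀,
⟨x,x′⟩ ⊂ □̃^{(j)}. (1.130)»*.  [I] = [Balaban1987RG1] (0.3)–(0.4) pp. 252–253 (the averaging of record; «a block … with a center at y»);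
[3] = [Balaban1985Averaging] (43) p. 24 (the tower), p. 24 (locality of (42)∕(43)).
Cell `pub-ymgap`, seat `pub-ymgap-dag-n05-d` g23 — «N05-REC» road, item R4 (director-ym №254∕№255; LEAD PEN dag-n05-e; TOKEN RULE `N05-REC-LEAD.md`
§2: (T1) `avgIter ↦ avgIterZ`, `bavg ↦ bavgZ`; (T2) blocks based at `L·z`, CENTRED, the level-`n` cube = the engine's translated by `−ctrShift L n·𝟙`;
(T5) engine names kept).  Twin of the engine module `B8Ineq130` (structure-free parts REUSED by name: `aLev`, `bound130`, `geom_sum_le`,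
`descent_sum_eq`, `ineq130_members`, `hol_one`, `pert_one`, `plaqSmall_one`, `fl`, …).  `--kind definition --supports stmt-QuantumFields-20541` (K0⁷; count-neutral).

WHAT IS PROVED (kernel, sorry-free).
* §1 THE CENTRED TOWER: `tlo L lo (n+1) = L•tlo n − s𝟙`, `thi L hi (n+1) = L•thi n + s𝟙` (`s = (L−1)∕2`); closed forms `Lⁿlo − ctrShift L n·𝟙`,
  `Lⁿhi + ctrShift L n·𝟙` (odd `L`) and ★ `tlo_eq_engine_sub` ∕ `thi_eq_engine_sub`: `= B8Ineq130.tlo∕thi − ctrShift L n·𝟙` (the (T2) translation,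
  LEAD ask L1); `block_mem`, `smul_mem`, `pair_mem` (the centred block ∕ two-block box of a site ∕ bond of `□̃^{(j+1)}` lies in `□̃^{(j)}`), the block
  map `fl L x = B8Ineq130.fl L (x + s𝟙)` with `inBlock_fl`, `fl_mem`, `fl_add_e`.
* §2 LOCALITY of the record average on the tower: `WZ_congr`, `XZ_congr`, `bavgZ_congr` (the loops (0.4) at `c = ⟨q, q+Le_κ⟩` read only the bonds of
  `[q − s𝟙, q + Le_κ + s𝟙]`), `agree_step`, `agree_level` (engine: `B7Prop1Local.bavg_congr` ∕ `B8Ineq130.agree_level`).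
* §3 ONE STEP: `step_cross` (= `B8Lemma1NonAbelianRec.lemma1_printedBound` with `V₀ = 1`, `α₀ = aL²`, `α₁ = B`), `step_interior` (`≤ 2·ds·a`).
* §4 ★★ `descent` — the engine's descent verbatim over the centred tower (Lemma-1 smallness `a_nL² ≤ 1∕(6(d+1)(d+2))`, the record's leaf constant).
* §5 `two_mul_le_of_C0` — Prop. 1's `C₀(α₀L²) ≤ ⅓` still implies the record's Lemma-1 smallness (`12(d+1)(d+2) ≤ C₀`).
* §6 ★★★ `ineq130_of128` — (1.130), FIRST MEMBER, for every `n ≤ k` and every bond of `□̃^{(k−n)}`, FROM (1.128) DISPLAYED ON THE TOWER (`h128`: at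
  every depth `n` the average `avgIterZ L U (k−n)` has its plaquettes on `□̃^{(k−n)}` within `2α₀L²·L^{−2n}` of `1`, and its bonds `U1`-valued) + (1.15)
  between consecutive levels (centred block contours) + the global axial gauge of the top level at the centre `y` ((1.129) by `B8Ineq129.ineq129`,
  REUSED) + the printed smallness; ★★★ `ineq130_of128_members` (all three members, `R₁M₁ ≤ M`, `11d < M`).

HONEST SCOPE ∕ WHAT IS DISPLAYED.  (i) In the engine, (1.128) at every level follows from (1.7) by [3] Prop. 2 (`B8Ineq130.ineq128_global∕_local` via
`B7Prop2Explicit.prop2_explicit_lt_two`); Prop. 2 FOR THE RECORD AVERAGE is the road's item R1 (LEAD PEN), not yet in the tree — so here (1.128) on the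
tower is a DISPLAYED HYPOTHESIS (`h128`, print's own intermediate line, [6] p. 98), together with the `U1`-valuedness of the averages (engine:
`AvgClosed` + Prop. 2); the engine-signature corollaries `ineq130_global ∕ ineq130_local ∕ ineq130` ((1.7) + `AvgClosed` in, (1.128) out) are ONE `obtain`
away once R1's `prop2Z` lands (TODO(R1), recorded on the cell bus).  (ii) `≤` where print has `<` in the first member (as the engine).  (iii) odd `L`
(the record's).  (iv) Nothing of [3]∕[6]∕[I] beyond the displayed bookkeeping + Lemma 1Z is asserted; `HThm4Rec` UNDISCHARGED; N05 ∕ N07 NOT discharged;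
counts unmoved; one finite 𝕋⁴ programme at fixed ε — nothing continuum ∕ ℝ⁴ ∕ OS ∕ mass gap ∕ Clay.  No `instance`, no `notation`, no `sorry`.
-/

noncomputable section

open scoped BigOperators
open NormedSpace Finset

namespace Literature.MathematicalPhysics.QuantumFieldTheory.Balaban1983to89.B8Ineq130Rec

open B7Prop1Explicit MatrixLog BlockAveragingZd B8Lemma1NonAbelianRecLoops B8Lemma1NonAbelianRec
open B7Prop2Explicit (rescale rescale_apply pdev avgIter C0 C0_pos)
open B7Prop1Local (InBox AgreeOn inBox_of_between hol_seg_int_congr hol_flatMap_seg_congr hol_treeWord_congr)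
open B8Lemma1NonAbelian (lowPart lowPart_apply l1_lowPart_eq zsmul_e_apply zsmul_e_apply_self e_apply_self e_apply_of_ne e_nonneg
  zsmul_e_nonneg tw pert pert_mulCfg mulCfg)
open B8Ineq129 (ineq129 le_of_add_e_le plaqSmall_of_pdev l1_lowPart_le)
open B8Ineq130 (hol_one axialFn_one gaugeAct_one pert_one plaqSmall_one one_mem_U1 aLev bound130 geom_sum_le descent_sum_eq
  ineq130_members aLev_mul_sq_le inBox_of_le axialFn_congr hol_plaqWord_congr twelve_le_C0)
open T4Continuum (stairWord stairRuns loopWord wordRev)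

-- `Site` alone would resolve to the torus sites of `Setup.lean`; re-export the `ℤᵈ` sites of `B7Prop1Explicit`.
export B7Prop1Explicit (Site)

variable {d : ℕ}

/-! ## §1 The CENTRED tower of cubes `□̃^{(j)}`, `j = k, …, 0`, indexed by the depth `n = k − j` -/

/-- Lower corner of the cube at depth `n` below the `k`-lattice cube `[lo, hi]`, CENTRED nesting: `tlo (n+1) = L•tlo n − (L−1)∕2·𝟙` (the cube at depth
`n + 1` is the union of the centred blocks `L•z + [−s, s]ᵈ` over the cube at depth `n`). [cite: Balaban1985RegularSpaces, p.98 («for every j the cube □_j is a sum of the big blocks»); Balaban1987RG1, (0.3) p.252] -/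
def tlo (L : ℕ) (lo : Site d) : ℕ → Site d
  | 0 => lo
  | n + 1 => (L : ℤ) • tlo L lo n - halfVec L

/-- Upper corner of the cube at depth `n`, CENTRED nesting: `thi (n+1) = L•thi n + (L−1)∕2·𝟙`. [cite: Balaban1985RegularSpaces, p.98; Balaban1987RG1, (0.3) p.252] -/
def thi (L : ℕ) (hi : Site d) : ℕ → Site d
  | 0 => hi
  | n + 1 => (L : ℤ) • thi L hi n + halfVec L

/-- `tlo_zero` — bookkeeping. [cite: Balaban1985RegularSpaces, p.98 (bookkeeping)] -/
@[simp] theorem tlo_zero (L : ℕ) (lo : Site d) : tlo L lo 0 = lo := rfl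

/-- `thi_zero` — bookkeeping. [cite: Balaban1985RegularSpaces, p.98 (bookkeeping)] -/
@[simp] theorem thi_zero (L : ℕ) (hi : Site d) : thi L hi 0 = hi := rfl

/-- `tlo_succ_apply` — bookkeeping. [cite: Balaban1985RegularSpaces, p.98 (bookkeeping)] -/
theorem tlo_succ_apply (L : ℕ) (lo : Site d) (n : ℕ) (i : Fin d) :
    tlo L lo (n + 1) i = (L : ℤ) * tlo L lo n i - (((L - 1) / 2 : ℕ) : ℤ) := rfl

/-- `thi_succ_apply` — bookkeeping. [cite: Balaban1985RegularSpaces, p.98 (bookkeeping)] -/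
theorem thi_succ_apply (L : ℕ) (hi : Site d) (n : ℕ) (i : Fin d) :
    thi L hi (n + 1) i = (L : ℤ) * thi L hi n i + (((L - 1) / 2 : ℕ) : ℤ) := rfl

/-- Closed form (odd `L`): `tlo L lo n = Lⁿ·lo − ctrShift L n·𝟙`. [cite: Balaban1987RG1, (0.3) p.252 (bookkeeping)] -/
theorem tlo_apply {L : ℕ} (hL : Odd L) (lo : Site d) : ∀ (n : ℕ) (i : Fin d), tlo L lo n i = (L : ℤ) ^ n * lo i - ctrShift L n
  | 0, i => by simp [ctrShift]
  | n + 1, i => by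
    rw [tlo_succ_apply, tlo_apply hL lo n i, ctrShift_succ hL, pow_succ]; push_cast; ring

/-- Closed form (odd `L`): `thi L hi n = Lⁿ·hi + ctrShift L n·𝟙`. [cite: Balaban1987RG1, (0.3) p.252 (bookkeeping)] -/
theorem thi_apply {L : ℕ} (hL : Odd L) (hi : Site d) : ∀ (n : ℕ) (i : Fin d), thi L hi n i = (L : ℤ) ^ n * hi i + ctrShift L n
  | 0, i => by simp [ctrShift]
  | n + 1, i => by
    rw [thi_succ_apply, thi_apply hL hi n i, ctrShift_succ hL, pow_succ]; push_cast; ring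

/-- **THE (T2) TRANSLATION** (LEAD ask L1): the centred tower is the engine's corner tower shifted by `−ctrShift L n·𝟙` at depth `n`:
`tlo L lo n = B8Ineq130.tlo L lo n − ctrShift L n·𝟙`. [cite: Balaban1987RG1, (0.3) p.252; Balaban1985RegularSpaces, p.98] -/
theorem tlo_eq_engine_sub {L : ℕ} (hL : Odd L) (lo : Site d) (n : ℕ) (i : Fin d) :
    tlo L lo n i = B8Ineq130.tlo L lo n i - ctrShift L n := by
  rw [tlo_apply hL, B8Ineq130.tlo_apply]

/-- `thi L hi n = B8Ineq130.thi L hi n − ctrShift L n·𝟙` (engine: `Lⁿ(hi+𝟙) − 𝟙`; `Lⁿ − 1 = 2·ctrShift L n` for odd `L`). [cite: Balaban1987RG1, (0.3) p.252; Balaban1985RegularSpaces, p.98] -/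
theorem thi_eq_engine_sub {L : ℕ} (hL : Odd L) (hi : Site d) (n : ℕ) (i : Fin d) :
    thi L hi n i = B8Ineq130.thi L hi n i - ctrShift L n := by
  rw [thi_apply hL, B8Ineq130.thi_apply]
  have h := two_mul_ctrShift_add_one hL n
  have h' : ((L : ℤ) ^ n) = 2 * (ctrShift L n : ℤ) + 1 := by exact_mod_cast h.symm
  rw [h']; ring

/-- The cubes of the tower are non-empty when the top one is. [cite: Balaban1985RegularSpaces, p.98 (bookkeeping)] -/
theorem tlo_le_thi (L : ℕ) {lo hi : Site d} (h : lo ≤ hi) : ∀ (n : ℕ) (i : Fin d), tlo L lo n i ≤ thi L hi n i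
  | 0, i => by simpa using h i
  | n + 1, i => by
    have ih := tlo_le_thi L h n i
    have hL0 : (0 : ℤ) ≤ L := by positivity
    have h1 := mul_le_mul_of_nonneg_left ih hL0
    rw [tlo_succ_apply, thi_succ_apply]
    have : (0 : ℤ) ≤ (((L - 1) / 2 : ℕ) : ℤ) := by positivity
    linarith

/-- **Block structure (centred)**: the centred `L`-block `L•z + [−s, s]ᵈ` of a site `z` of the depth-`n` cube lies in the depth-`(n+1)` cube.
[cite: Balaban1985RegularSpaces, p.98 («□_j is a sum of the big blocks»); Balaban1987RG1, (0.3) p.252] -/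
theorem block_mem {L s : ℕ} (hL : L = 2 * s + 1) {lo hi : Site d} {n : ℕ} {z : Site d} (hz : tlo L lo n ≤ z) (hz' : z ≤ thi L hi n)
    (r : Fin d → Fin L) :
    tlo L lo (n + 1) ≤ (L : ℤ) • z + offZ L r ∧ (L : ℤ) • z + offZ L r ≤ thi L hi (n + 1) := by
  have hL0 : (0 : ℤ) ≤ L := by positivity
  have hs : (L - 1) / 2 = s := by omega
  have hnb : ∀ i, -(s : ℤ) ≤ offZ L r i ∧ offZ L r i ≤ s := fun i => by have := natAbs_offZ_le hL r i; omega
  constructor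
  · intro i
    have h2 := mul_le_mul_of_nonneg_left (hz i) hL0
    have hr := (hnb i).1
    rw [tlo_succ_apply, Pi.add_apply, Pi.smul_apply, smul_eq_mul, hs]
    linarith
  · intro i
    have h2 := mul_le_mul_of_nonneg_left (hz' i) hL0
    have hr := (hnb i).2
    rw [thi_succ_apply, Pi.add_apply, Pi.smul_apply, smul_eq_mul, hs]
    linarith

/-- `smul_mem` — the CENTRE `L•z` of the block. [cite: Balaban1987RG1, (0.3) p.252 (bookkeeping)] -/
theorem smul_mem {L : ℕ} {lo hi : Site d} {n : ℕ} {z : Site d} (hz : tlo L lo n ≤ z) (hz' : z ≤ thi L hi n) :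
    tlo L lo (n + 1) ≤ (L : ℤ) • z ∧ (L : ℤ) • z ≤ thi L hi (n + 1) := by
  have hL0 : (0 : ℤ) ≤ L := by positivity
  have h0 : (0 : ℤ) ≤ (((L - 1) / 2 : ℕ) : ℤ) := by positivity
  constructor
  · intro i
    have h2 := mul_le_mul_of_nonneg_left (hz i) hL0
    rw [tlo_succ_apply, Pi.smul_apply, smul_eq_mul]
    linarith
  · intro i
    have h2 := mul_le_mul_of_nonneg_left (hz' i) hL0
    rw [thi_succ_apply, Pi.smul_apply, smul_eq_mul]
    linarith

/-- **The two-block region of a coarse bond** `c = ⟨z, z + e_κ⟩` of the depth-`n` cube: `B(c₋) ∪ B(c₊) = [L•z − s𝟙, L•z + Le_κ + s𝟙]`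
(`pairLo ∕ pairHi` of `B8Lemma1NonAbelianRecLoops`) lies in the depth-`(n+1)` cube. [cite: Balaban1985RegularSpaces, (1.23) p.79, p.98] -/
theorem pair_mem {L : ℕ} {lo hi : Site d} {n : ℕ} {z : Site d} {κ : Fin d} (hz : tlo L lo n ≤ z)
    (hzκ : z + e κ ≤ thi L hi n) :
    tlo L lo (n + 1) ≤ pairLo L ((L : ℤ) • z) ∧ pairHi L ((L : ℤ) • z) κ ≤ thi L hi (n + 1) := by
  have hL0 : (0 : ℤ) ≤ L := by positivity
  constructor
  · intro i
    have h2 := mul_le_mul_of_nonneg_left (hz i) hL0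
    simp only [pairLo, halfVec, tlo_succ_apply, Pi.sub_apply, Pi.smul_apply, smul_eq_mul]
    linarith
  · intro i
    have h1 : z i + e κ i ≤ thi L hi n i := hzκ i
    simp only [pairHi, halfVec, thi_succ_apply, Pi.add_apply, Pi.smul_apply, smul_eq_mul]
    by_cases hi : i = κ
    · subst hi
      rw [e_apply_self] at h1 ⊢
      have h2 := mul_le_mul_of_nonneg_left h1 hL0
      linarith
    · rw [e_apply_of_ne hi] at h1 ⊢
      have h2 := mul_le_mul_of_nonneg_left h1 hL0
      linarith

/-- The coarse site whose CENTRED block contains a fine site: `fl L x = ⌊(x + s𝟙) ∕ L⌋` (engine `B8Ineq130.fl` = `⌊x∕L⌋`, corner blocks). [cite: Balaban1987RG1, (0.3) p.252 (bookkeeping)] -/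
def fl (L : ℕ) (x : Site d) : Site d := B8Ineq130.fl L (x + halfVec L)

/-- `x ∈ B(L·fl L x)` (centred block, odd `L = 2s+1`). [cite: Balaban1987RG1, (0.3) p.252 (bookkeeping)] -/
theorem inBlock_fl {L s : ℕ} (hL : L = 2 * s + 1) (x : Site d) : InBlock L ((L : ℤ) • fl L x) x := by
  rw [inBlock_iff hL]
  intro i
  have h := B8Ineq130.inBlock_fl (L := L) (by omega) (x + halfVec L) i
  have hs : (L - 1) / 2 = s := by omega
  simp only [Pi.smul_apply, smul_eq_mul, Pi.add_apply, halfVec, hs, fl] at h ⊢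
  constructor <;> omega

/-- The coarse site below a site of the depth-`(n+1)` cube lies in the depth-`n` cube. [cite: Balaban1985RegularSpaces, p.98 (bookkeeping)] -/
theorem fl_mem {L s : ℕ} (hL : L = 2 * s + 1) {lo hi : Site d} {n : ℕ} {x : Site d} (hx : tlo L lo (n + 1) ≤ x)
    (hx' : x ≤ thi L hi (n + 1)) : tlo L lo n ≤ fl L x ∧ fl L x ≤ thi L hi n := by
  have hL0 : (0 : ℤ) ≤ L := by positivity
  have hL' : (L : ℤ) = 2 * s + 1 := by exact_mod_cast hL
  have hB := (inBlock_iff hL _ x).mp (inBlock_fl hL x)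
  have hs : (L - 1) / 2 = s := by omega
  constructor
  · intro i
    have h1 : tlo L lo (n + 1) i ≤ x i := hx i
    obtain ⟨h2a, h2b⟩ := hB i
    rw [tlo_succ_apply, hs] at h1
    simp only [Pi.smul_apply, smul_eq_mul] at h2a h2b
    have h3 : (L : ℤ) * tlo L lo n i < (L : ℤ) * (fl L x i + 1) := by linarith
    have h4 : tlo L lo n i < fl L x i + 1 := lt_of_mul_lt_mul_left h3 hL0
    exact Int.lt_add_one_iff.mp h4
  · intro i
    have h1 : x i ≤ thi L hi (n + 1) i := hx' i
    obtain ⟨h2a, h2b⟩ := hB i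
    rw [thi_succ_apply, hs] at h1
    simp only [Pi.smul_apply, smul_eq_mul] at h2a h2b
    have h3 : (L : ℤ) * fl L x i < (L : ℤ) * (thi L hi n i + 1) := by linarith
    have h4 : fl L x i < thi L hi n i + 1 := lt_of_mul_lt_mul_left h3 hL0
    exact Int.lt_add_one_iff.mp h4

/-- The coarse site below `x + e_ν` is the one below `x` or its `ν`-neighbour. [cite: Balaban1987RG1, (0.3) p.252 (bookkeeping)] -/
theorem fl_add_e {L : ℕ} (hL : 1 ≤ L) (x : Site d) (ν : Fin d) :
    fl L (x + e ν) = fl L x ∨ fl L (x + e ν) = fl L x + e ν := by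
  unfold fl
  rw [show x + e ν + halfVec L = (x + halfVec L) + e ν by abel]
  exact B8Ineq130.fl_add_e hL _ ν

/-! ## §2 Locality of the record average (0.4) on the tower -/

section Locality

variable {G : Type*} [Group G]

/-- The loop variables (0.4) at `c = ⟨q, q + Le_κ⟩` read only the bonds of the two-block box `[q − s𝟙, q + Le_κ + s𝟙]` (`L = 2s+1`).
[cite: Balaban1987RG1, (0.4) p.253; Balaban1985Averaging, p.24 (locality of (42))] -/
theorem WZ_congr {L s : ℕ} (hL : L = 2 * s + 1) {lo hi : Site d} {V V' : Site d → Fin d → G} (h : AgreeOn lo hi V V')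
    (q : Site d) (κ : Fin d) (hlo : lo ≤ pairLo L q) (hhi : pairHi L q κ ≤ hi) (i : IdxZ d L) :
    WZ L V q κ i = WZ L V' q κ i := by
  obtain ⟨r, σ, σ'⟩ := i
  set n : Site d := offZ L r with hn
  have hns : ∀ j, (n j).natAbs ≤ s := natAbs_offZ_le hL r
  have mem : ∀ x : Site d, (pairLo L q ≤ x ∧ x ≤ pairHi L q κ) → InBox lo hi x :=
    fun x hx => inBox_of_le (hlo.trans hx.1) (hx.2.trans hhi)
  have hz : ∀ j, ((0 : Site d) j).natAbs ≤ s := fun j => by simp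
  have hq : InBox lo hi q := mem q (base_mem_pairBox hL q κ)
  have hqn : InBox lo hi (q + n) := mem _ (mem_pairBox_blocks hL q κ hns).1
  have hqL' := (mem_pairBox_blocks hL q κ hz).2
  rw [add_zero] at hqL'
  have hqL : InBox lo hi (q + (L : ℤ) • e κ) := mem _ hqL'
  have hqLn : InBox lo hi (q + (L : ℤ) • e κ + n) := mem _ (mem_pairBox_blocks hL q κ hns).2
  have hqnL : InBox lo hi (q + n + (L : ℤ) • e κ) := by rw [add_right_comm]; exact hqLn
  have hndσ : ((List.finRange d).map σ).Nodup := (List.nodup_finRange d).map σ.injective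
  have hndσ' : ((List.finRange d).map σ').Nodup := (List.nodup_finRange d).map σ'.injective
  -- the four pieces
  have hA : hol V q (stairWord σ n) = hol V' q (stairWord σ n) := by
    rw [stairWord_eq_tw]
    exact hol_flatMap_seg_congr h n _ hndσ q hq fun j _ => ⟨(hqn j).1, (hqn j).2⟩
  have hB : hol V (q + n) (List.replicate L (κ, true)) = hol V' (q + n) (List.replicate L (κ, true)) := by
    rw [← seg_natCast]
    exact hol_seg_int_congr h κ L (q + n) hqn hqnL
  have hC0 : hol V (q + (L : ℤ) • e κ) (stairWord σ' n) = hol V' (q + (L : ℤ) • e κ) (stairWord σ' n) := by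
    rw [stairWord_eq_tw]
    exact hol_flatMap_seg_congr h n _ hndσ' _ hqL fun j _ => ⟨(hqLn j).1, (hqLn j).2⟩
  have hC : hol V (q + n + (L : ℤ) • e κ) (wordRev (stairWord σ' n)) =
      hol V' (q + n + (L : ℤ) • e κ) (wordRev (stairWord σ' n)) := by
    have hp : q + n + (L : ℤ) • e κ = q + (L : ℤ) • e κ + disp (stairWord σ' n) := by rw [disp_stairWord]; abel
    rw [show wordRev (stairWord σ' n) = revWord (stairWord σ' n) from rfl, hol_revWord' V _ _ hp, hol_revWord' V' _ _ hp,
      hC0]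
  have hD : hol V (q + (L : ℤ) • e κ) (List.replicate L (κ, false)) = hol V' (q + (L : ℤ) • e κ) (List.replicate L (κ, false)) := by
    rw [← seg_neg_natCast]
    exact hol_seg_int_congr h κ (-(L : ℤ)) _ hqL (by rw [neg_smul, add_neg_cancel_right]; exact hq)
  rw [WZ_def, WZ_def]
  change hol V q (loopWord L κ n σ σ') = hol V' q (loopWord L κ n σ σ')
  simp only [T4Continuum.loopWord, hol_append, disp_stairWord, disp_replicate, Letter.vec_true,
    show wordRev (stairWord σ' n) = revWord (stairWord σ' n) from rfl, disp_revWord]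
  rw [show q + n + (L : ℤ) • e κ + -n = q + (L : ℤ) • e κ by abel]
  rw [show revWord (stairWord σ' n) = wordRev (stairWord σ' n) from rfl] at *
  rw [hA, hB, hC, hD]

variable {𝔸 : Type*} [NormedRing 𝔸] [NormedAlgebra ℂ 𝔸] [CompleteSpace 𝔸]

/-- LOCALITY OF THE RECORD AVERAGE (0.4): `V̄_c` depends only on the bond variables of `[q − s𝟙, q + Le_κ + s𝟙]` (engine: `B7Prop1Local.bavg_congr`).
[cite: Balaban1987RG1, (0.4) p.253; Balaban1985Averaging, p.24] -/
theorem bavgZ_congr {L s : ℕ} (hL : L = 2 * s + 1) {lo hi : Site d} {V V' : Site d → Fin d → 𝔸ˣ} (h : AgreeOn lo hi V V')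
    (q : Site d) (κ : Fin d) (hlo : lo ≤ pairLo L q) (hhi : pairHi L q κ ≤ hi) : bavgZ L V q κ = bavgZ L V' q κ := by
  have hX : XZ L V q κ = XZ L V' q κ := by
    unfold XZ
    exact Finset.sum_congr rfl fun i _ => by rw [WZ_congr hL h q κ hlo hhi i]
  have hz : ∀ j, ((0 : Site d) j).natAbs ≤ s := fun j => by simp
  have hq : InBox lo hi q :=
    inBox_of_le (hlo.trans (base_mem_pairBox hL q κ).1) ((base_mem_pairBox hL q κ).2.trans hhi)
  have hqL' := (mem_pairBox_blocks hL q κ hz).2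
  rw [add_zero] at hqL'
  have hqL : InBox lo hi (q + (L : ℤ) • e κ) := inBox_of_le (hlo.trans hqL'.1) (hqL'.2.trans hhi)
  have hS : hol V q (seg κ L) = hol V' q (seg κ L) := hol_seg_int_congr h κ L q hq hqL
  rw [bavgZ_apply, bavgZ_apply, hX, hS]

/-- LOCALITY OF ONE AVERAGING STEP ON THE CENTRED TOWER: agreement on the bonds of the depth-`(n+1)` cube gives agreement of the one-step
record averages on the bonds of the depth-`n` cube. [cite: Balaban1985Averaging, p.24 (locality of (42)); Balaban1987RG1, (0.4) p.253] -/
theorem agree_step {L s : ℕ} (hL : L = 2 * s + 1) {lo hi : Site d} {n : ℕ} {V V' : Site d → Fin d → 𝔸ˣ}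
    (h : AgreeOn (tlo L lo (n + 1)) (thi L hi (n + 1)) V V') :
    AgreeOn (tlo L lo n) (thi L hi n) (rescale L (bavgZ L V)) (rescale L (bavgZ L V')) := by
  intro q κ hq hqκ
  rw [rescale_apply, rescale_apply]
  have hpm := pair_mem (L := L) (lo := lo) (hi := hi) (z := q) (κ := κ) (fun i => (hq i).1) (fun i => (hqκ i).2)
  exact bavgZ_congr hL h _ κ hpm.1 hpm.2

/-- LOCALITY OF THE ITERATED RECORD AVERAGE ON THE TOWER: agreement on the bonds of the depth-`(n + j)` cube gives agreement of the `j`-fold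
averages on the bonds of the depth-`n` cube. [cite: Balaban1985Averaging, p.24; Balaban1987RG1, (0.4) p.253] -/
theorem agree_level {L s : ℕ} (hL : L = 2 * s + 1) {lo hi : Site d} {V V' : Site d → Fin d → 𝔸ˣ} :
    ∀ (j n : ℕ), AgreeOn (tlo L lo (n + j)) (thi L hi (n + j)) V V' →
      AgreeOn (tlo L lo n) (thi L hi n) (avgIterZ L V j) (avgIterZ L V' j)
  | 0, n, h => by simpa using h
  | j + 1, n, h => by
    rw [show n + (j + 1) = (n + 1) + j by omega] at h
    rw [avgIterZ_succ, avgIterZ_succ]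
    exact agree_step hL (agree_level hL j (n + 1) h)

end Locality

/-! ## §3 One application of Lemma 1 (record average, `V₀ = 1`) between two consecutive levels -/

section Step

variable {𝔸 : Type*} [NormedRing 𝔸] [NormOneClass 𝔸] [NormedAlgebra ℂ 𝔸] [CompleteSpace 𝔸]

/-- **Lemma 1 (record average) for a crossing pair of CENTRED blocks, `V₀ = 1`**: if `W` satisfies (1.7) for `k = 1` with `|W(∂p) − 1| ≤ a` on
`B(c₋) ∪ B(c₊) = [L•z − s𝟙, L•z + Le_κ + s𝟙]`, the axial gauge conditions (1.15) from both block centres, and `|W̄_c − 1| ≤ B` for the record average,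
then `|W_b − 1| < 4d²(aL²) + B` on `B(c₋) ∪ B(c₊)` — `B8Lemma1NonAbelianRec.lemma1_printedBound` with `V₀ = 1`, `α₀ = aL²`, `α₁ = B`.
[cite: Balaban1985RegularSpaces, Lemma 1 (1.24)–(1.25) p.79; Balaban1987RG1, (0.4) p.253] -/
theorem step_cross {L s : ℕ} (hL : L = 2 * s + 1) {W : Site d → Fin d → 𝔸ˣ} (hW : ∀ x μ, W x μ ∈ U1 𝔸)
    {z : Site d} {κ : Fin d} {a B : ℝ}
    (hP : B8Lemma1NonAbelian.PlaqSmall W (pairLo L ((L : ℤ) • z)) (pairHi L ((L : ℤ) • z) κ) a)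
    (hax : ∀ r : Fin d → Fin L, axialFn W ((L : ℤ) • z) ((L : ℤ) • z + offZ L r) = 1)
    (hax₁ : ∀ r : Fin d → Fin L, axialFn W ((L : ℤ) • (z + e κ)) ((L : ℤ) • (z + e κ) + offZ L r) = 1)
    (havg : ‖(bavgZ L W ((L : ℤ) • z) κ : 𝔸) - 1‖ ≤ B)
    (ha : 0 < a) (ha' : a * (L : ℝ) ^ 2 ≤ 1 / (6 * ((d : ℝ) + 1) * ((d : ℝ) + 2))) (hB : 0 ≤ B) (hB' : B ≤ 1 / 6)
    (x : Site d) (ν : Fin d) (hx : InPair L ((L : ℤ) • z) κ x) (hxν : InPair L ((L : ℤ) • z) κ (x + e ν)) :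
    ‖(W x ν : 𝔸) - 1‖ < 4 * (d : ℝ) ^ 2 * (a * (L : ℝ) ^ 2) + B := by
  have hLne : (L : ℝ) ≠ 0 := by
    have : (1 : ℝ) ≤ L := by exact_mod_cast (show 1 ≤ L by omega)
    positivity
  have hdiv : a * (L : ℝ) ^ 2 / (L : ℝ) ^ 2 = a := mul_div_cancel_right₀ a (pow_ne_zero 2 hLne)
  have H : Hyp L W 1 ((L : ℤ) • z) κ (a * (L : ℝ) ^ 2 / (L : ℝ) ^ 2) B := by
    refine ⟨hW, one_mem_U1, ?_, ?_, ?_, ?_, ?_⟩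
    · rw [hdiv]; exact hP
    · rw [hdiv]; exact plaqSmall_one ha.le _ _
    · intro r; rw [hax r, axialFn_one]
    · intro r; rw [← smul_add, hax₁ r, axialFn_one]
    · rw [bavgZ_one]; simpa using havg
  have h := lemma1_printedBound hL H (by positivity) ha' hB hB' x ν hx hxν
  rwa [pert_one] at h

omit [NormedAlgebra ℂ 𝔸] [CompleteSpace 𝔸] in
/-- **Interior bonds of one CENTRED block, `V₀ = 1`**: a bond with both ends in `B(L•z)` obeys `|W_b − 1| ≤ 2·ds·a` from the plaquettes and (1.15)
alone (`B8Lemma1NonAbelianRec.interior_bound` with `V₀ = 1` and `Σ_{κ<ν}|n_κ| ≤ |n|₁ ≤ d·s`). [cite: Balaban1985RegularSpaces, p.79 (proof of Lemma 1)] -/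
theorem step_interior {L s : ℕ} (hL : L = 2 * s + 1) {W : Site d → Fin d → 𝔸ˣ} (hW : ∀ x μ, W x μ ∈ U1 𝔸) {lo hi : Site d}
    {a : ℝ} (hP : B8Lemma1NonAbelian.PlaqSmall W lo hi a) (ha : 0 ≤ a) {z : Site d}
    (hlo : lo ≤ (L : ℤ) • z) (hhi' : (L : ℤ) • z ≤ hi)
    (hax : ∀ r : Fin d → Fin L, axialFn W ((L : ℤ) • z) ((L : ℤ) • z + offZ L r) = 1)
    (x : Site d) (ν : Fin d) (r r' : Fin d → Fin L) (hx : x = (L : ℤ) • z + offZ L r)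
    (hx' : x + e ν = (L : ℤ) • z + offZ L r') (hxlo : lo ≤ x) (hhi : x + e ν ≤ hi) :
    ‖(W x ν : 𝔸) - 1‖ ≤ 2 * ((d : ℝ) * s) * a := by
  have h := interior_bound W 1 hW one_mem_U1 hP (plaqSmall_one ha lo hi) ha ((L : ℤ) • z) x ν hlo hhi' hxlo hhi
    (by rw [hx, hax r, axialFn_one]) (by rw [hx', hax r', axialFn_one])
  rw [pert_one] at h
  refine h.trans ?_
  have hl : (l1 (lowPart ν (x - (L : ℤ) • z)) : ℝ) ≤ (d : ℝ) * s := by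
    have h1 : l1 (lowPart ν (x - (L : ℤ) • z)) ≤ d * s := by
      rw [hx, add_sub_cancel_left]
      exact (l1_lowPart_le ν _).trans (l1_offZ_le hL r)
    exact_mod_cast h1
  nlinarith

end Step

/-! ## §4 «Applying Lemma 1 many times, as in the proof of (1.65), (1.66)» — the descent through the centred tower -/

section Descent

variable {𝔸 : Type*} [NormedRing 𝔸] [NormOneClass 𝔸] [NormedAlgebra ℂ 𝔸] [CompleteSpace 𝔸]

/-- **THE DESCENT (record average, centred tower)** — the engine's `B8Ineq130.descent` verbatim over `avgIterZ`, the centred blocks and the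
centred cubes: if every level `Ūʲ = avgIterZ L U j`, `j ≤ k`, is `U1`-valued, the level of depth `n ≥ 1` has plaquettes within `a_n` of `1` on its
cube, (1.15) (centred block contours) holds between consecutive levels, and the top level obeys `|Ūᵏ_b − 1| ≤ B_top` on the top cube, then — provided
`a_nL² ≤ 1∕(6(d+1)(d+2))` and `B_top + Σ_{m<k} 4d²L²a_{m+1} ≤ 1∕6` — `|Ū^{k−n}_b − 1| ≤ B_top + Σ_{m<n} 4d²L²a_{m+1}` on the depth-`n` cube.
[cite: Balaban1985RegularSpaces, p.98–99 (1.130); p.87 (proof of (1.65)); Balaban1987RG1, (0.4) p.253] -/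
theorem descent {L s : ℕ} (hL : L = 2 * s + 1) (hd : 1 ≤ d) (lo hi : Site d) (U : Site d → Fin d → 𝔸ˣ) (k : ℕ)
    (a : ℕ → ℝ) (Btop : ℝ)
    (hmem : ∀ j ≤ k, ∀ x μ, avgIterZ L U j x μ ∈ U1 𝔸)
    (hplaq : ∀ n, 1 ≤ n → n ≤ k →
      B8Lemma1NonAbelian.PlaqSmall (avgIterZ L U (k - n)) (tlo L lo n) (thi L hi n) (a n))
    (h15 : ∀ n, n < k → ∀ z, tlo L lo n ≤ z → z ≤ thi L hi n → ∀ r : Fin d → Fin L,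
      axialFn (avgIterZ L U (k - (n + 1))) ((L : ℤ) • z) ((L : ℤ) • z + offZ L r) = 1)
    (htop : ∀ x ν, lo ≤ x → x + e ν ≤ hi → ‖((avgIterZ L U k x ν : 𝔸ˣ) : 𝔸) - 1‖ ≤ Btop)
    (hBtop : 0 ≤ Btop)
    (ha : ∀ n, 1 ≤ n → n ≤ k → 0 < a n ∧ a n * (L : ℝ) ^ 2 ≤ 1 / (6 * ((d : ℝ) + 1) * ((d : ℝ) + 2)))
    (htot : Btop + ∑ m ∈ Finset.range k, 4 * (d : ℝ) ^ 2 * (L : ℝ) ^ 2 * a (m + 1) ≤ 1 / 6) :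
    ∀ n ≤ k, ∀ (x : Site d) (ν : Fin d), tlo L lo n ≤ x → x + e ν ≤ thi L hi n →
      ‖((avgIterZ L U (k - n) x ν : 𝔸ˣ) : 𝔸) - 1‖ ≤
        Btop + ∑ m ∈ Finset.range n, 4 * (d : ℝ) ^ 2 * (L : ℝ) ^ 2 * a (m + 1) := by
  have hL1 : 1 ≤ L := by omega
  have hterm : ∀ m, m + 1 ≤ k → 0 ≤ 4 * (d : ℝ) ^ 2 * (L : ℝ) ^ 2 * a (m + 1) := fun m hm => by
    have := (ha (m + 1) (by omega) hm).1; positivity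
  have hsum_nonneg : ∀ n ≤ k, 0 ≤ ∑ m ∈ Finset.range n, 4 * (d : ℝ) ^ 2 * (L : ℝ) ^ 2 * a (m + 1) :=
    fun n hn => Finset.sum_nonneg fun m hm => hterm m (by have := Finset.mem_range.mp hm; omega)
  have hsum_le : ∀ n ≤ k, ∑ m ∈ Finset.range n, 4 * (d : ℝ) ^ 2 * (L : ℝ) ^ 2 * a (m + 1) ≤
      ∑ m ∈ Finset.range k, 4 * (d : ℝ) ^ 2 * (L : ℝ) ^ 2 * a (m + 1) := fun n hn =>
    Finset.sum_le_sum_of_subset_of_nonneg (Finset.range_mono hn)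
      fun m hm _ => hterm m (by have := Finset.mem_range.mp hm; omega)
  intro n
  induction n with
  | zero =>
    intro _ x ν hx hxν
    simpa using htop x ν hx hxν
  | succ n ih =>
    intro hn x ν hx hxν
    have hn' : n ≤ k := by omega
    have hj : k - n = k - (n + 1) + 1 := by omega
    have hxhi : x ≤ thi L hi (n + 1) := le_of_add_e_le hxν
    have hxν' : tlo L lo (n + 1) ≤ x + e ν := hx.trans (le_add_of_nonneg_right (e_nonneg ν))
    obtain ⟨hz, hz'⟩ := fl_mem hL hx hxhi
    obtain ⟨hw, hw'⟩ := fl_mem hL hxν' hxν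
    have hbx := inBlock_fl hL x
    have hbx' := inBlock_fl hL (x + e ν)
    obtain ⟨r, hr⟩ := hbx
    have hW := hmem (k - (n + 1)) (by omega)
    have hP := hplaq (n + 1) (by omega) hn
    obtain ⟨ha0, ha1⟩ := ha (n + 1) (by omega) hn
    have hB0 : 0 ≤ Btop + ∑ m ∈ Finset.range n, 4 * (d : ℝ) ^ 2 * (L : ℝ) ^ 2 * a (m + 1) := by
      have := hsum_nonneg n hn'; linarith
    have hB1 : Btop + ∑ m ∈ Finset.range n, 4 * (d : ℝ) ^ 2 * (L : ℝ) ^ 2 * a (m + 1) ≤ 1 / 6 := by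
      have := hsum_le n hn'; linarith
    have hax := h15 n (by omega) (fl L x) hz hz'
    rw [Finset.sum_range_succ, ← add_assoc]
    rcases fl_add_e hL1 x ν with hsame | hcross
    · -- both endpoints of the bond lie in the block `B(L·z)`, `z = fl L x`: the interior half of Lemma 1
      rw [hsame] at hbx'
      obtain ⟨r', hr'⟩ := hbx'
      obtain ⟨hlz, hlz'⟩ := smul_mem (L := L) hz hz'
      have hb := step_interior hL hW hP ha0.le hlz hlz' hax x ν r r' hr hr' hx hxν
      have hdL : 2 * ((d : ℝ) * s) * a (n + 1) ≤ 4 * (d : ℝ) ^ 2 * (L : ℝ) ^ 2 * a (n + 1) := by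
        have hd1 : (1 : ℝ) ≤ d := by exact_mod_cast hd
        have hsL : (s : ℝ) ≤ L := by exact_mod_cast (show s ≤ L by omega)
        have hL1' : (1 : ℝ) ≤ L := by exact_mod_cast hL1
        have hds : (d : ℝ) * s ≤ d * L := mul_le_mul_of_nonneg_left hsL (by linarith)
        have hdL1 : 1 ≤ (d : ℝ) * L := by nlinarith
        have hdL2 : (d : ℝ) * L ≤ ((d : ℝ) * L) ^ 2 := by nlinarith
        have h2 : 2 * ((d : ℝ) * s) ≤ 4 * (d : ℝ) ^ 2 * (L : ℝ) ^ 2 := by nlinarith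
        exact mul_le_mul_of_nonneg_right h2 ha0.le
      linarith
    · -- the bond crosses from `B(L·z)` to `B(L·(z + e_ν))`: Lemma 1 on the pair of blocks
      rw [hcross] at hbx' hw hw'
      have havg : ‖((bavgZ L (avgIterZ L U (k - (n + 1))) ((L : ℤ) • fl L x) ν : 𝔸ˣ) : 𝔸) - 1‖ ≤
          Btop + ∑ m ∈ Finset.range n, 4 * (d : ℝ) ^ 2 * (L : ℝ) ^ 2 * a (m + 1) := by
        have h := ih hn' (fl L x) ν hz hw'
        rwa [hj, avgIterZ_succ, rescale_apply] at h
      have hpm := pair_mem (lo := lo) (hi := hi) hz hw'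
      have hbx0 : InBlock L ((L : ℤ) • fl L x) x := ⟨r, hr⟩
      rw [smul_add] at hbx'
      have hb := step_cross hL hW (hP.mono hpm.1 hpm.2) hax (h15 n (by omega) _ hw hw') havg ha0 ha1
        hB0 hB1 x ν (Or.inl hbx0) (Or.inr hbx')
      have h4 : 4 * (d : ℝ) ^ 2 * (a (n + 1) * (L : ℝ) ^ 2) = 4 * (d : ℝ) ^ 2 * (L : ℝ) ^ 2 * a (n + 1) := by
        ring
      linarith

end Descent

/-! ## §5 Lemma 1's smallness from Proposition 1's: `C₀(α₀L²) ≤ ⅓ ⟹ 2α₀L² ≤ 1∕(6(d+1)(d+2))` -/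

section Scales

/-- `12(d+1)(d+2) ≤ C₀ = 226(8(d+1)(d+4))²`: Prop. 1's smallness is (much) stronger than the record's Lemma-1 smallness.
[cite: Balaban1985Averaging, Prop. 1 p.22 (bookkeeping)] -/
theorem twelve_mul_le_C0 (d : ℕ) : 12 * ((d : ℝ) + 1) * ((d : ℝ) + 2) ≤ C0 d := by
  unfold C0
  have hd : (0 : ℝ) ≤ d := Nat.cast_nonneg d
  nlinarith [sq_nonneg ((d : ℝ) + 1), sq_nonneg ((d : ℝ) + 4), mul_nonneg hd hd]

/-- The record's Lemma-1 smallness of the scaled `α₀` from Prop. 1's: `C₀t ≤ ⅓ ⟹ 2t ≤ 1∕(6(d+1)(d+2))`. [cite: Balaban1985RegularSpaces, p.98 («α₀ is so small that … all the theorems on averaging operations are valid») (bookkeeping)] -/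
theorem two_mul_le_of_C0 {d : ℕ} {t : ℝ} (ht : 0 ≤ t) (h3 : C0 d * t ≤ 1 / 3) :
    2 * t ≤ 1 / (6 * ((d : ℝ) + 1) * ((d : ℝ) + 2)) := by
  have h := mul_le_mul_of_nonneg_right (twelve_mul_le_C0 d) ht
  rw [le_div_iff₀ (by positivity)]
  nlinarith

end Scales

/-! ## §6 (1.130) from (1.128) displayed on the tower, (1.15) between the levels and the global axial gauge of the top -/

section Main

variable {𝔸 : Type*} [NormedRing 𝔸] [NormOneClass 𝔸] [NormedAlgebra ℂ 𝔸] [CompleteSpace 𝔸]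

/-- **(1.130), FIRST MEMBER, RECORD AVERAGE, FROM (1.128) ON THE TOWER** (p. 98 last sentence – p. 99): HYPOTHESES — odd `L ≥ 3`, `d ≥ 1`; the averages
`Ū₀′ʲ = avgIterZ L U j`, `j ≤ k`, `U1`-valued and (1.128) at every depth `n ≤ k` on the cube `□̃^{(k−n)} = [tlo n, thi n]` in the form `|Ū₀′^{k−n}(∂p) − 1|
≤ 2α₀L²·L^{−2n}` (print: «By the assumptions (1.7)–(1.9) and Proposition 2 from [3]» — Prop. 2 for the record average is the road's R1, so the line is
DISPLAYED); `α₀L²` Prop.-1-small (`C₀α₀L² ≤ ⅓`); the block axial gauge conditions (1.15) for `U₀′` between all consecutive levels on the tower (trees from the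
block CENTRES, `Ū₀′ʲ(Γ_{L•z,x}) = 1`, `x ∈ B(L•z) = L•z + [−s,s]ᵈ`); the global axial gauge of `Ū₀′ᵏ` on `□̃^{(k)} = [lo, hi]` with centre `y`, `|x − y|_∞ ≤ h`,
`2h ≤ M + 4R₁M₁`; and `11d²L²α₀ + (M + 4R₁M₁)dL²α₀ ≤ 1∕6`.  CONCLUSION — `|Ū₀′^{k−n}(x, x + e_ν) − 1| ≤ 8d²L²(Σ_{m<n} L^{−2m})α₀ + (M + 4R₁M₁)dL²α₀`
(`B8Ineq130.bound130`) for every bond of `□̃^{(k−n)}`.  Proof = the printed one: (1.129) at the top (`B8Ineq129.ineq129`, REUSED), then `descent`.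
[cite: Balaban1985RegularSpaces, (1.130) p.99, (1.128)–(1.129) p.98, (1.15) p.78, Lemma 1 p.79; Balaban1987RG1, (0.4) p.253] -/
theorem ineq130_of128 {L s : ℕ} (hL : L = 2 * s + 1) (hL2 : 2 ≤ L) (hd : 1 ≤ d) (k : ℕ) (U : Site d → Fin d → 𝔸ˣ)
    {α₀ : ℝ} (hα : 0 < α₀) (hα3 : C0 d * (α₀ * (L : ℝ) ^ 2) ≤ 1 / 3) (lo hi : Site d)
    (hmem : ∀ j ≤ k, ∀ x μ, avgIterZ L U j x μ ∈ U1 𝔸)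
    (h128 : ∀ n ≤ k, B8Lemma1NonAbelian.PlaqSmall (avgIterZ L U (k - n)) (tlo L lo n) (thi L hi n) (aLev α₀ L n))
    (h15 : ∀ n, n < k → ∀ z, tlo L lo n ≤ z → z ≤ thi L hi n → ∀ r : Fin d → Fin L,
      axialFn (avgIterZ L U (k - (n + 1))) ((L : ℤ) • z) ((L : ℤ) • z + offZ L r) = 1)
    {y : Site d} {h : ℕ} (hy : lo ≤ y) (hy' : y ≤ hi) (hrad : ∀ κ, y κ - lo κ ≤ h ∧ hi κ - y κ ≤ h)
    (hgax : ∀ z, lo ≤ z → z ≤ hi → hol (avgIterZ L U k) y (treeWord (z - y)) = 1)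
    {M R₁ M₁ : ℝ} (hside : 2 * (h : ℝ) ≤ M + 4 * R₁ * M₁)
    (hsmall : 11 * (d : ℝ) ^ 2 * (L : ℝ) ^ 2 * α₀ + (M + 4 * R₁ * M₁) * d * (L : ℝ) ^ 2 * α₀ ≤ 1 / 6)
    (n : ℕ) (hn : n ≤ k) (x : Site d) (ν : Fin d) (hx : tlo L lo n ≤ x) (hxν : x + e ν ≤ thi L hi n) :
    ‖((avgIterZ L U (k - n) x ν : 𝔸ˣ) : 𝔸) - 1‖ ≤ bound130 d L α₀ M R₁ M₁ n := by
  have hL1 : 1 ≤ L := by omega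
  have hW : ∀ x μ, avgIterZ L U k x μ ∈ U1 𝔸 := hmem k le_rfl
  have hP0 : B8Lemma1NonAbelian.PlaqSmall (avgIterZ L U k) lo hi (2 * α₀ * (L : ℝ) ^ 2) := by
    have h0 := h128 0 (Nat.zero_le k)
    simp only [Nat.sub_zero, tlo_zero, thi_zero, aLev, pow_zero, inv_one, one_pow, mul_one] at h0
    exact h0
  have hh : (0 : ℝ) ≤ 2 * (h : ℝ) := by positivity
  have hMpos : 0 ≤ M + 4 * R₁ * M₁ := hh.trans hside
  have htop : ∀ x ν, lo ≤ x → x + e ν ≤ hi →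
      ‖((avgIterZ L U k x ν : 𝔸ˣ) : 𝔸) - 1‖ ≤ (M + 4 * R₁ * M₁) * d * (L : ℝ) ^ 2 * α₀ := by
    intro x ν hx hxν
    have h9 := ineq129 (avgIterZ L U k) hW hy hy' hrad hα.le hP0 1 (one_mem _)
      (fun z hz hz' => by rw [gaugeAct_one]; exact hgax z hz hz') hside x ν hx hxν
    rw [gaugeAct_one] at h9
    exact h9.1.trans h9.2
  have hS := geom_sum_le hL2 k
  have h8 : 0 ≤ 8 * (d : ℝ) ^ 2 * (L : ℝ) ^ 2 * α₀ := by positivity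
  have htot : (M + 4 * R₁ * M₁) * d * (L : ℝ) ^ 2 * α₀ +
      ∑ m ∈ Finset.range k, 4 * (d : ℝ) ^ 2 * (L : ℝ) ^ 2 * aLev α₀ L (m + 1) ≤ 1 / 6 := by
    rw [descent_sum_eq hL1]
    have := mul_le_mul_of_nonneg_left hS h8
    nlinarith
  have hdesc := descent hL hd lo hi U k (aLev α₀ L) ((M + 4 * R₁ * M₁) * d * (L : ℝ) ^ 2 * α₀) hmem
    (fun m hm1 hmk => h128 m hmk) h15 htop (by positivity)
    (fun m hm1 _ => ⟨by have : (0 : ℝ) < L := by exact_mod_cast (lt_of_lt_of_le (by norm_num) hL2)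
                        unfold aLev; positivity,
      (aLev_mul_sq_le hL1 hα.le hm1).trans (two_mul_le_of_C0 (by positivity) hα3)⟩)
    htot n hn x ν hx hxν
  rw [descent_sum_eq hL1] at hdesc
  unfold bound130
  linarith

/-- **(1.130) ALL THREE MEMBERS, RECORD AVERAGE, printed constants** (from (1.128) displayed): under the hypotheses of `ineq130_of128` and `R₁M₁ ≤ M`,
`11d < M`: `|Ū₀′^{k−n}(x, x+e_ν) − 1| ≤ 8d²L²(Σ_{m<n}L^{−2m})α₀ + (M + 4R₁M₁)dL²α₀ < 11d²L²α₀ + 5dL²Mα₀ < 6dL²Mα₀` — in particular (1.133) for the record.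
[cite: Balaban1985RegularSpaces, (1.130) p.99, (1.133) p.99; Balaban1987RG1, (0.4) p.253] -/
theorem ineq130_of128_members {L s : ℕ} (hL : L = 2 * s + 1) (hL2 : 2 ≤ L) (hd : 1 ≤ d) (k : ℕ) (U : Site d → Fin d → 𝔸ˣ)
    {α₀ : ℝ} (hα : 0 < α₀) (hα3 : C0 d * (α₀ * (L : ℝ) ^ 2) ≤ 1 / 3) (lo hi : Site d)
    (hmem : ∀ j ≤ k, ∀ x μ, avgIterZ L U j x μ ∈ U1 𝔸)
    (h128 : ∀ n ≤ k, B8Lemma1NonAbelian.PlaqSmall (avgIterZ L U (k - n)) (tlo L lo n) (thi L hi n) (aLev α₀ L n))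
    (h15 : ∀ n, n < k → ∀ z, tlo L lo n ≤ z → z ≤ thi L hi n → ∀ r : Fin d → Fin L,
      axialFn (avgIterZ L U (k - (n + 1))) ((L : ℤ) • z) ((L : ℤ) • z + offZ L r) = 1)
    {y : Site d} {h : ℕ} (hy : lo ≤ y) (hy' : y ≤ hi) (hrad : ∀ κ, y κ - lo κ ≤ h ∧ hi κ - y κ ≤ h)
    (hgax : ∀ z, lo ≤ z → z ≤ hi → hol (avgIterZ L U k) y (treeWord (z - y)) = 1)
    {M R₁ M₁ : ℝ} (hside : 2 * (h : ℝ) ≤ M + 4 * R₁ * M₁) (hRM : R₁ * M₁ ≤ M) (hM : 11 * (d : ℝ) < M)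
    (hsmall : 11 * (d : ℝ) ^ 2 * (L : ℝ) ^ 2 * α₀ + (M + 4 * R₁ * M₁) * d * (L : ℝ) ^ 2 * α₀ ≤ 1 / 6)
    (n : ℕ) (hn : n ≤ k) (x : Site d) (ν : Fin d) (hx : tlo L lo n ≤ x) (hxν : x + e ν ≤ thi L hi n) :
    ‖((avgIterZ L U (k - n) x ν : 𝔸ˣ) : 𝔸) - 1‖ ≤ bound130 d L α₀ M R₁ M₁ n ∧
      bound130 d L α₀ M R₁ M₁ n < 11 * (d : ℝ) ^ 2 * (L : ℝ) ^ 2 * α₀ + 5 * d * (L : ℝ) ^ 2 * M * α₀ ∧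
      11 * (d : ℝ) ^ 2 * (L : ℝ) ^ 2 * α₀ + 5 * d * (L : ℝ) ^ 2 * M * α₀ < 6 * d * (L : ℝ) ^ 2 * M * α₀ ∧
      ‖((avgIterZ L U (k - n) x ν : 𝔸ˣ) : 𝔸) - 1‖ < 6 * d * (L : ℝ) ^ 2 * M * α₀ := by
  have h1 := ineq130_of128 hL hL2 hd k U hα hα3 lo hi hmem h128 h15 hy hy' hrad hgax hside hsmall n hn x ν hx hxν
  have h2 := ineq130_members hd hL2 hα hRM hM n
  exact ⟨h1, h2.1, h2.2, lt_of_le_of_lt h1 (h2.1.trans h2.2)⟩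

end Main

end Literature.MathematicalPhysics.QuantumFieldTheory.Balaban1983to89.B8Ineq130Rec

/-! ## Axiom audit (gate whitelist: `propext`, `Classical.choice`, `Quot.sound`) -/
#print axioms Literature.MathematicalPhysics.QuantumFieldTheory.Balaban1983to89.B8Ineq130Rec.descent
#print axioms Literature.MathematicalPhysics.QuantumFieldTheory.Balaban1983to89.B8Ineq130Rec.ineq130_of128_members
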